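import Literature.MathematicalPhysics.QuantumFieldTheory.Balaban1983to89.B9Ineq368PPrime

/-!
# `Balaban1983to89.B9Ineq377POne` — B9 p. 405–406 (3.76)–(3.77): the kernel bound for the non-local operator `P₁(A)` of
# `D_{U′U}R(U′U)D*_{U′U} = DRD* − V₂(A) − P₁(A)`, in the block-majorant (operator) form of [4] (2.51), DERIVED from the
# (3.49)-entries of `P(U)`, the (3.68)-entries of `P′(A)` and the size of the first-order letters `D_{U′U} − D_U`, `D*_{U′U} − D*_U`

HONEST FRAMING (cell `lit-balaban`, verbatim): statement-level skeleton of published theorems with citation tags; proofs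
where landed; nothing here is a claim about the Yang–Mills mass gap.

CITATION HEADER (lean-in-tree rule).  T. Bałaban, *Propagators for lattice gauge theories in a background field*, Commun.
Math. Phys. **99** (1985) 389–434 [`Balaban1985BackgroundPropagators`] (cell paper B9; journal page = PDF page + 388):
p. 405 [PDF 17] (3.74)–(3.76) and p. 406 [PDF 18] (3.77) with the sentence introducing it; p. 399 [PDF 11] (3.49); p. 403
[PDF 15] (3.68); p. 396 [PDF 8] (3.37); [4] = T. Bałaban, *Propagators and renormalization transformations for lattice gauge
theories. II*, Commun. Math. Phys. **96** (1984) 223–250 [`Balaban1984PropagatorsII`], (2.51)–(2.55) p. 232, Lemma 2.1 p. 234,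
(2.68) p. 235.  Text read from the held text layer (`lit read paper:balaban1985-cmp99-background-propagators --pages 14-20`)
and the renders `b2b-balaban-ref1/pages/1985-cmp99-background-propagators/…-p017-x2.png`, `…-p018-x2.png` READ AS IMAGES by
this seat (2026-08-21).  Cell `lit-balaban` seat r06 gen 7 (B9 fold owner), SKELETON row `B9.Eq3.76` (whose status so far
read «(ring algebra of (3.76)); (3.77) typed as hypothesis shape»).  Continuation of the same seat's `B9Ineq366CPrime` /
`B9Ineq368PPrime` (gen 6; their composition lemmas and the (3.49)/(3.68) operator forms are used BY NAME) and of pv27's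
`B9Eq386Neumann` (`pOne` = the printed `P₁(A)`, `eq376`; used BY NAME).

WHAT IS PRINTED («…» verbatim).  p. 405: «These expansions imply the following one: D_{U′U}R(U′U)D\*_{U′U} = D_UR(U)D\*_U −
V₂(A) − (D_{U′U} − D_U)P(U)D\*_U − D_UP(U)(D\*_{U′U} − D\*_U) − (D_{U′U} − D_U)P(U)(D\*_{U′U} − D\*_U) − D_{U′U}P′(A)D\*_{U′U} =
DRD\* − V₂(A) − P₁(A), (3.76)»  p. 406: «where the operator P₁(A) is a non-local operator whose kernel satisfies the bound
|P_{1,μν}(A; x, x′)| ≦ O(1)α₁(Lʲη)⁻²(L^{j′}η)^{−d}e^{−(1/2)δ₀d(y,y′)} for x ∈ Δ(y), y ∈ Λ_j, x′ ∈ Δ(y′), y′ ∈ Λ_{j′}. (3.77)  Of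
course, all the functions and operators introduced above are analytic on the domain (3.37).»  The letters: p. 405 (3.74)
«(D\*_{U′U}A′)(x) = (D\*_UA′)(x) + Σ_ν η⁻¹[exp(−ηi ad_{R(U(x,x−ηe_ν))A_ν(x−ηe_ν)}) − 1]·R(U(x, x − ηe_ν))A′_ν(x − ηe_ν)», p. 404
(3.70) (the same first-order expansion for `D_{U′U}`), p. 396 (3.37) «|A| < α₁(Lʲη)⁻¹ … on Bʲ(Λ_j)»; p. 399 (3.49) and p. 403
(3.68) (the four kernel entries of `P = I − R` and of `P′(A)`, `P(U′U) = P(U) + P′(A)`).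

WHAT THIS FILE PROVES (theorems; one real-constant definition with body `kappa377`; no `Prop` placeholders, 0 new facts;
standard axioms).  SETTING as in `B9Ineq368PPrime`: pv08's `B6RandomWalk.HasMajorant` over `B9Thm34Ext.toB6`, all letters
in ONE `Module.End ℝ (W → ℝ)` with block map `blk : W → 𝔅` (`W` carries sites, bonds and blocks, so that the derivative
letters `D = D_U`, `Ds = D*_U` and their `U′U`-versions `D′`, `Ds′` are elements too).
* §1 `pOne_expand` — with `E := D′ − D`, `E* := D*′ − D*` the printed `P₁(A)` (`B9Eq386Neumann.pOne`) is the sum of the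
  seven words `E·(PD*) + (DP)·E* + E·P·E* + D·P′·D* + E·(P′D*) + (DP′)·E* + E·P′·E*` (ring algebra).
* §2 **`ineq377_op`** — (3.77) in block-majorant (operator) form: from the (3.49)-shaped entries `P ≺ κ_P e^{−δd}`,
  `D·P ≺ κ_P(Lʲη)⁻¹e^{−δd}`, `P·D* ≺ κ_P(Lʲη)⁻¹e^{−δd}`, the (3.68)-shaped entries `P′ ≺ κ_{P′}α₁e^{−δd}`, `D·P′`, `P′·D* ≺
  κ_{P′}α₁(Lʲη)⁻¹e^{−δd}`, `D·P′·D* ≺ κ_{P′}α₁(Lʲη)⁻²e^{−δd}`, and the first-order letters `E`, `E* ≺ c_Eα₁(Lʲη)⁻¹e^{−δd}`, with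
  the scale transfer of the p. 398 remark for the weight `(Lʲη)⁻¹` at exponent `α` (constant `Λ`), (2.61) at `β` and (2.54):
  **`P₁(A) ≺ κ₃₇₇·α₁·(Lʲη)⁻²·e^{−ρ d(y,y′)}`** for every rate `ρ ≧ 0` with `ρ + 2(α+β)δ₀ ≦ δ`, **`κ₃₇₇ = κ_{P′} + Λc·c_E·(2κ_P +
  c_Eα₁κ_Pc + 2α₁κ_{P′} + c_Eα₁²κ_{P′}c)`**, `c = c₁(β)` of [4] (2.61) — every word carries at least one small factor `α₁`.
* §3 **`ineq377_op_of_349`** — the same with `P = P(U) = B9Eq360Vprime.pOp G Qs Cinv Q` ((3.25)) and its three entries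
  DISCHARGED by gen 6's `B9Ineq368PPrime.ineq349_op` from the Theorem-3.1/3.2-shaped inputs (so `κ_P = κ₃₄₉`): the interfaces
  of the two files compose (rates: (3.49) at `ρ₁` with `ρ₁ + (2α+β)δ₀ ≦ δ`, then (3.77) at `ρ` with `ρ + 2(α+β)δ₀ ≦ ρ₁`).

SCOPE / NOT CLAIMED.  (i) OPERATOR (block `L^∞ → L^∞`) FORM, as in `B9Ineq368PPrime` (i): the printed POINTWISE kernel bound
(3.77) with its factor `(L^{j′}η)^{−d}` is stronger; the operator form is what the Neumann step (3.84)–(3.86) consumes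
(`B9Eq386Neumann` §4, `B9Thm34Ext`).  (ii) The (3.68) entries `P′D*`, `DP′D*` enter as hypotheses OF THE PRINTED SHAPE — they
are printed in (3.68) but not derived in the block-sup calculus (`B9Ineq368PPrime` (ii): Hölder zone, cell GAPS G-B9-02); the
entries `P′`, `DP′` are gen 6's `ineq368_op`/`ineq368_op_D` when wanted.  (iii) The majorant `c_Eα₁(Lʲη)⁻¹e^{−δd}` of `E =
D_{U′U} − D_U` is the READING of (3.70)/(3.74) + (3.37): `E` is the nearest-neighbour-local first-order letter
`η⁻¹[exp(ηi ad_{RA}) − 1]R(U)·` of sup-size `O(1)|A| ≦ O(1)α₁(Lʲη)⁻¹`, and a local letter of reach one bond has the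
(2.51)-majorant `c_E·(…)·e^{−δd}` as soon as `c_E` absorbs `O(1)e^{δ·d₁}`, `d₁` = the largest multiscale distance of adjacent
blocks — this identification on a concrete carrier is the reader's (pv27's `B9Eq370Expansion`/`B9Eq375Composition` hold the
pointwise letters).  (iv) Rates: `ρ` is any rate with the stated margin below the COMMON input rate `δ` (the print's «½δ₀» in
its re-defined-constants convention, cf. `B9Ineq349.rates_349`, GAPS G-B9-21).  (v) Nothing of `V₂(A)` ((3.75), pv27
`B9Eq375Composition`), of (3.78)–(3.86), analyticity, or any theorem of the series' end-statement.  Value = one asserted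
«whose kernel satisfies the bound» step of the printed proof of Theorem 3.4 kernel-checked in operator form with its constant,
NOT summit progress.

RELATED IN THE TREE, NOT DUPLICATED (searched 2026-08-21: `ls Balaban1983to89/ | grep -i '377\|383\|385'` = ∅, `grep -lw pOne`
= `B9Eq386Neumann`, `B9Eq360Vprime`, `B9Eq373V3*`): `B9Eq386Neumann` §1 (`pOne`, `eq376`, `eq376_line1` — the ring algebra of
(3.76), USED BY NAME; (3.77) there is a hypothesis shape only); `B9Ineq368PPrime` ((3.49)/(3.68) operator forms, USED BY NAME);
`B9Ineq366CPrime` (composition lemmas, USED BY NAME); `B9Eq375Composition`/`B9Eq375Locality` (pv27: `V₂`, (3.75), pointwise);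
`B9Eq370Expansion` (pv27: the (3.70) expansion of `D_{U′U}`, pointwise).  None derives (3.77).
-/

noncomputable section

namespace Literature.MathematicalPhysics.QuantumFieldTheory.Balaban1983to89.B9Ineq377POne

open Literature.MathematicalPhysics.QuantumFieldTheory.Balaban1983to89
open Literature.MathematicalPhysics.QuantumFieldTheory.Balaban1983to89.B6RandomWalk (HasMajorant BlockSupp
  hasMajorant_mono hasMajorant_mul hasMajorant_add Triangle254 Ineq261)
open Literature.MathematicalPhysics.QuantumFieldTheory.Balaban1983to89.B9Thm34Ext (toB6)
open Literature.MathematicalPhysics.QuantumFieldTheory.Balaban1983to89.B9Ineq347 (ScaleTransfer)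
open Literature.MathematicalPhysics.QuantumFieldTheory.Balaban1983to89.B9Ineq366CPrime (hasMajorant_comp_decay
  hasMajorant_comp_decay_right1 hasMajorant_rate_mono)
open Literature.MathematicalPhysics.QuantumFieldTheory.Balaban1983to89.B9Eq386Neumann (pOne)

/-! ## §1  The seven words of `P₁(A)` -/

section Words

variable {S : Type*} [Ring S]

/-- **(3.76) expanded**: writing `D_{U′U} = D_U + E`, `D*_{U′U} = D*_U + E*` (the first-order expansions (3.70), (3.74)),
the printed `P₁(A) = (D′−D)PD* + DP(D′*−D*) + (D′−D)P(D′*−D*) + D′P′(A)D′*` (`B9Eq386Neumann.pOne`) is the sum of seven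
words, each containing at least one small letter (`E`, `E*` or `P′`):
`E·(PD*) + (DP)·E* + E·P·E* + D·P′·D* + E·(P′D*) + (DP′)·E* + E·P′·E*`. [cite: Balaban1985BackgroundPropagators, (3.76) p.405] -/
theorem pOne_expand (D E Ds Es P Pp : S) :
    pOne D (D + E) Ds (Ds + Es) P Pp =
      E * (P * Ds) + D * P * Es + E * P * Es + D * Pp * Ds + E * (Pp * Ds) + D * Pp * Es + E * Pp * Es := by
  simp only [pOne]
  noncomm_ring

end Words

/-! ## §2  (3.77) in block-majorant (operator) form -/

section Ineq377

variable {g : B9.Geometry} [Fintype g.Site] {R : ℝ} {H : Prop} {W : Type}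

/-- The explicit `O(1)` of (3.77) produced here: with `κ_P` the (3.49)-constant of the entries of `P(U)`, `κ_{P′}` the
(3.68)-constant of the entries of `P′(A)` (both WITHOUT the factor `α₁`), `c_E` the constant of the first-order letters
`D_{U′U} − D_U`, `D*_{U′U} − D*_U`, `Λ` the scale-transfer constant and `c = c₁(β)` of [4] (2.61):
`κ₃₇₇ = κ_{P′} + Λc·c_E·(2κ_P + c_Eα₁κ_Pc + 2α₁κ_{P′} + c_Eα₁²κ_{P′}c)` (the seven words of `pOne_expand`, in order:
`c_Eκ_PΛc`, `κ_Pc_EΛc`, `c_E²α₁κ_PΛc²`, `κ_{P′}`, `c_Eα₁κ_{P′}Λc`, `α₁κ_{P′}c_EΛc`, `c_E²α₁²κ_{P′}Λc²`, times the common `α₁`).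
[cite: Balaban1985BackgroundPropagators, (3.77) p.406] -/
def kappa377 (cE κP κP' Λ c α₁ : ℝ) : ℝ :=
  κP' + Λ * c * cE * (2 * κP + cE * α₁ * κP * c + 2 * α₁ * κP' + cE * α₁ ^ 2 * κP' * c)

/-- `κ₃₇₇ ≧ 0` for non-negative constants. [cite: Balaban1985BackgroundPropagators, (3.77) p.406] -/
theorem kappa377_nonneg {cE κP κP' Λ c α₁ : ℝ} (hcE : 0 ≤ cE) (hκP : 0 ≤ κP) (hκP' : 0 ≤ κP') (hΛ : 0 ≤ Λ)
    (hc : 0 ≤ c) (hα₁ : 0 ≤ α₁) : 0 ≤ kappa377 cE κP κP' Λ c α₁ := by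
  unfold kappa377
  positivity

/-- **(3.77) p. 406 — «the operator P₁(A) is a non-local operator whose kernel satisfies the bound |P_{1,μν}(A;x,x′)| ≦
O(1)α₁(Lʲη)⁻²(L^{j′}η)^{−d}e^{−(1/2)δ₀d(y,y′)}» — in the block-majorant (operator) form of [4] (2.51).**  LETTERS (one
homogeneous calculus, `W` ∋ sites, bonds, blocks): `D = D_U`, `Ds = D*_U`, `D′ = D_{U′U} = D + E`, `Ds′ = D*_{U′U} = Ds + Es`
((3.70)/(3.74)), `P = P(U) = I − R(U)`, `Pp = P′(A)` ((3.68): `P(U′U) = P + P′`); `P₁(A) = B9Eq386Neumann.pOne D D′ Ds Ds′ P Pp`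
((3.76)).  INPUTS of printed shape, all at a common rate `δ`: (3.49) for `P`, `D·P`, `P·D*` (constant `κ_P`; the fourth
entry `D·P·D*` is not needed); (3.68) for `P′`, `D·P′`, `P′·D*`, `D·P′·D*` (constant `κ_{P′}α₁`); the first-order local letters
`E`, `Es` with majorant `c_Eα₁(Lʲη)⁻¹e^{−δd}` («η⁻¹[exp(ηi ad_{RA}) − 1]R(U)·» of (3.70)/(3.74), sup-size `O(1)|A| ≦
O(1)α₁(Lʲη)⁻¹` by (3.37)); Lemma 2.1 of [4]: the scale transfer of the weight `(Lʲη)⁻¹` at exponent `α` with constant `Λ`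
(`B9Ineq347.scaleTransfer_of_260`), (2.61) at exponent `β`, the triangle inequality (2.54), `d ≧ 0`, `Lʲη > 0`.  CONCLUSION:
for every `ρ ≧ 0` with `ρ + 2(α+β)δ₀ ≦ δ` (two nesting levels of compositions in the words `E·P·E*`, `E·P′·E*`),
`P₁(A) ≺ κ₃₇₇·α₁·(Lʲη)⁻²·e^{−ρ d(y,y′)}` — i.e. `|(P₁(A)λ)(x)| ≦ κ₃₇₇α₁(Lʲη)⁻²e^{−ρd(y,y′)}|λ|` for `x ∈ Δ(y)`, `supp λ ⊂
Δ(y′)`, with `κ₃₇₇` EXPLICIT (`kappa377`).  Route = the print's «These expansions imply»: expand (§1), bound each of the seven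
words by [4] (2.52)–(2.55) + (2.68) (`B9Ineq366CPrime.hasMajorant_comp_decay`), add.
[cite: Balaban1985BackgroundPropagators, (3.76)–(3.77) pp.405–406 + (3.49) p.399 + (3.68) p.403 + (3.70)/(3.74) pp.404–405 + (3.37) p.396; Balaban1984PropagatorsII, Lemma 2.1 p.234 + (2.52)–(2.55) p.232] -/
theorem ineq377_op (blk : W → g.Site) (d : ℕ) (δ₀ δ α β ρ Λ cE κP κP' α₁ : ℝ)
    (hcE : 0 ≤ cE) (hκP : 0 ≤ κP) (hκP' : 0 ≤ κP') (hα₁ : 0 ≤ α₁) (hΛ : 1 ≤ Λ) (hρ : 0 ≤ ρ) (hα : 0 ≤ α)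
    (hβ : 0 ≤ β) (hδ₀ : 0 ≤ δ₀) (hr : ρ + 2 * ((α + β) * δ₀) ≤ δ)
    (hdnn : ∀ a b : g.Site, 0 ≤ g.dist a b) (htri : Triangle254 (toB6 g R H)) (hlen : ∀ y : g.Site, 0 < g.len y)
    (h261 : Ineq261 d (toB6 g R H) δ₀ β) (hT1i : ScaleTransfer g δ₀ α Λ (fun a => (g.len a)⁻¹))
    {D D' Ds Ds' E Es P Pp : Module.End ℝ (W → ℝ)} (hD' : D' = D + E) (hDs' : Ds' = Ds + Es)
    (hP : HasMajorant (g := toB6 g R H) blk P (fun a b => κP * Real.exp (-(δ * g.dist a b))))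
    (hDP : HasMajorant (g := toB6 g R H) blk (D * P) (fun a b => κP * (g.len a)⁻¹ * Real.exp (-(δ * g.dist a b))))
    (hPDs : HasMajorant (g := toB6 g R H) blk (P * Ds) (fun a b => κP * (g.len a)⁻¹ * Real.exp (-(δ * g.dist a b))))
    (hPp : HasMajorant (g := toB6 g R H) blk Pp (fun a b => κP' * α₁ * Real.exp (-(δ * g.dist a b))))
    (hDPp : HasMajorant (g := toB6 g R H) blk (D * Pp)
      (fun a b => κP' * α₁ * (g.len a)⁻¹ * Real.exp (-(δ * g.dist a b))))
    (hPpDs : HasMajorant (g := toB6 g R H) blk (Pp * Ds)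
      (fun a b => κP' * α₁ * (g.len a)⁻¹ * Real.exp (-(δ * g.dist a b))))
    (hDPpDs : HasMajorant (g := toB6 g R H) blk (D * Pp * Ds)
      (fun a b => κP' * α₁ * (g.len a ^ 2)⁻¹ * Real.exp (-(δ * g.dist a b))))
    (hE : HasMajorant (g := toB6 g R H) blk E (fun a b => cE * α₁ * (g.len a)⁻¹ * Real.exp (-(δ * g.dist a b))))
    (hEs : HasMajorant (g := toB6 g R H) blk Es (fun a b => cE * α₁ * (g.len a)⁻¹ * Real.exp (-(δ * g.dist a b)))) :
    HasMajorant (g := toB6 g R H) blk (pOne D D' Ds Ds' P Pp)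
      (fun a b => kappa377 cE κP κP' Λ (B6.c1 d δ₀ β) α₁ * α₁ * (g.len a ^ 2)⁻¹ * Real.exp (-(ρ * g.dist a b))) := by
  -- constants, weights and rates
  set c : ℝ := B6.c1 d δ₀ β with hc_def
  have hc0 : 0 ≤ c := B6RandomWalk.c1_nonneg d δ₀ β
  have hw1 : ∀ a : g.Site, 0 ≤ (g.len a)⁻¹ := fun a => inv_nonneg.mpr (hlen a).le
  have hw2 : ∀ a : g.Site, 0 ≤ (g.len a ^ 2)⁻¹ := fun a => inv_nonneg.mpr (sq_nonneg _)
  have hΛ0 : 0 ≤ Λ := zero_le_one.trans hΛ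
  have hcEα : 0 ≤ cE * α₁ := mul_nonneg hcE hα₁
  have hκP'α : 0 ≤ κP' * α₁ := mul_nonneg hκP' hα₁
  have hεnn : 0 ≤ (α + β) * δ₀ := by positivity
  have hαδ : 0 ≤ α * δ₀ := by positivity
  set r : ℝ := ρ + (α + β) * δ₀ with hr_def
  have hρr : ρ + (α + β) * δ₀ ≤ r := le_of_eq hr_def.symm
  have hρr' : ρ ≤ r := by rw [hr_def]; linarith
  have hr0 : 0 ≤ r := hρ.trans hρr'
  have hrδ : r + (α + β) * δ₀ ≤ δ := by rw [hr_def]; linarith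
  have hrδ' : r ≤ δ := by linarith
  have hρδ : ρ + (α + β) * δ₀ ≤ δ := hρr.trans hrδ'
  have hρδ' : ρ ≤ δ := hρr'.trans hrδ'
  -- rate-weakened letters
  have hPDsρ := hasMajorant_rate_mono (R := R) (H := H) blk κP (fun a => (g.len a)⁻¹) hκP hw1 hρδ' hdnn hPDs
  have hEsρ := hasMajorant_rate_mono (R := R) (H := H) blk (cE * α₁) (fun a => (g.len a)⁻¹) hcEα hw1 hρδ' hdnn hEs
  have hPpDsρ := hasMajorant_rate_mono (R := R) (H := H) blk (κP' * α₁) (fun a => (g.len a)⁻¹) hκP'α hw1 hρδ' hdnn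
    hPpDs
  have hDPpDsρ := hasMajorant_rate_mono (R := R) (H := H) blk (κP' * α₁) (fun a => (g.len a ^ 2)⁻¹) hκP'α hw2 hρδ'
    hdnn hDPpDs
  -- unweighted forms of `P`, `P′` (right factors of `E·P`, `E·P′` at the intermediate rate `r`)
  have hPr : HasMajorant (g := toB6 g R H) blk P (fun a b => κP * Real.exp (-(r * g.dist a b))) :=
    hasMajorant_mono (g := toB6 g R H) blk hP fun a b =>
      mul_le_mul_of_nonneg_left (Real.exp_le_exp.mpr (by nlinarith [hdnn a b])) hκP
  have hPpr : HasMajorant (g := toB6 g R H) blk Pp (fun a b => κP' * α₁ * Real.exp (-(r * g.dist a b))) :=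
    hasMajorant_mono (g := toB6 g R H) blk hPp fun a b =>
      mul_le_mul_of_nonneg_left (Real.exp_le_exp.mpr (by nlinarith [hdnn a b])) hκP'α
  -- word 1: `E·(P·D*)`
  have w1 := hasMajorant_comp_decay (R := R) (H := H) blk d δ₀ α β ρ δ Λ (cE * α₁) κP (fun a => (g.len a)⁻¹)
    (fun a => (g.len a)⁻¹) hw1 hw1 hΛ0 hcEα hκP hρ hρδ hdnn htri hT1i h261 hE hPDsρ
  -- word 2: `(D·P)·E*`
  have w2 := hasMajorant_comp_decay (R := R) (H := H) blk d δ₀ α β ρ δ Λ κP (cE * α₁) (fun a => (g.len a)⁻¹)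
    (fun a => (g.len a)⁻¹) hw1 hw1 hΛ0 hκP hcEα hρ hρδ hdnn htri hT1i h261 hDP hEsρ
  -- word 3: `(E·P)·E*`
  have w3a := hasMajorant_comp_decay_right1 (R := R) (H := H) blk d δ₀ α β r δ (cE * α₁) κP (fun a => (g.len a)⁻¹)
    hw1 hcEα hκP hr0 hαδ hrδ hdnn htri h261 hE hPr
  have w3 := hasMajorant_comp_decay (R := R) (H := H) blk d δ₀ α β ρ r Λ (cE * α₁ * κP * c) (cE * α₁)
    (fun a => (g.len a)⁻¹) (fun a => (g.len a)⁻¹) hw1 hw1 hΛ0 (by positivity) hcEα hρ hρr hdnn htri hT1i h261 w3a hEsρ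
  -- word 5: `E·(P′·D*)`
  have w5 := hasMajorant_comp_decay (R := R) (H := H) blk d δ₀ α β ρ δ Λ (cE * α₁) (κP' * α₁) (fun a => (g.len a)⁻¹)
    (fun a => (g.len a)⁻¹) hw1 hw1 hΛ0 hcEα hκP'α hρ hρδ hdnn htri hT1i h261 hE hPpDsρ
  -- word 6: `(D·P′)·E*`
  have w6 := hasMajorant_comp_decay (R := R) (H := H) blk d δ₀ α β ρ δ Λ (κP' * α₁) (cE * α₁) (fun a => (g.len a)⁻¹)
    (fun a => (g.len a)⁻¹) hw1 hw1 hΛ0 hκP'α hcEα hρ hρδ hdnn htri hT1i h261 hDPp hEsρ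
  -- word 7: `(E·P′)·E*`
  have w7a := hasMajorant_comp_decay_right1 (R := R) (H := H) blk d δ₀ α β r δ (cE * α₁) (κP' * α₁)
    (fun a => (g.len a)⁻¹) hw1 hcEα hκP'α hr0 hαδ hrδ hdnn htri h261 hE hPpr
  have w7 := hasMajorant_comp_decay (R := R) (H := H) blk d δ₀ α β ρ r Λ (cE * α₁ * (κP' * α₁) * c) (cE * α₁)
    (fun a => (g.len a)⁻¹) (fun a => (g.len a)⁻¹) hw1 hw1 hΛ0 (by positivity) hcEα hρ hρr hdnn htri hT1i h261 w7a
    hEsρ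
  -- assemble
  have hsum := hasMajorant_add (g := toB6 g R H) blk
    (hasMajorant_add (g := toB6 g R H) blk
      (hasMajorant_add (g := toB6 g R H) blk
        (hasMajorant_add (g := toB6 g R H) blk
          (hasMajorant_add (g := toB6 g R H) blk (hasMajorant_add (g := toB6 g R H) blk w1 w2) w3) hDPpDsρ) w5) w6) w7
  rw [hD', hDs', pOne_expand]
  refine hasMajorant_mono (g := toB6 g R H) blk hsum fun a b => le_of_eq ?_
  have ha : g.len a ≠ 0 := (hlen a).ne'
  simp only [kappa377]
  field_simp
  ring

end Ineq377

/-! ## §3  The same with the (3.49)-entries of `P(U) = G′Q′*(Q′G′²Q′*)⁻¹Q′G′` discharged by `B9Ineq368PPrime.ineq349_op` -/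

section Assembly

variable {g : B9.Geometry} [Fintype g.Site] [DecidableEq g.Site] {R : ℝ} {H : Prop} {W : Type}

/-- **(3.77) with the `P(U)`-entries DISCHARGED** from the Theorem-3.1/3.2-shaped inputs by gen 6's (3.49) operator form
(`B9Ineq368PPrime.ineq349_op`, `P(U) = B9Eq360Vprime.pOp G Qs Cinv Q` of (3.25), `κ_P = κ₃₄₉ = κ_Q²B₀²B₁Λ⁴c²`): (3.42)₁₋₃
for `G′`, `∇G′`, `G′∇*`, (3.48) for `(Q′G′²Q′*)⁻¹`, `Q′`, `Q′*` block-local (`κ_Q`), the scale transfers for `Lʲη`, `(Lʲη)²`,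
`(Lʲη)⁻⁴`, `(Lʲη)⁻¹`; the (3.68)-entries of `P′(A)` and the letters `E`, `E*` as in `ineq377_op`, all at the (3.49)-output
rate `ρ₁` (`ρ₁ + (2α+β)δ₀ ≦ δ`); conclusion at any `ρ ≧ 0` with `ρ + 2(α+β)δ₀ ≦ ρ₁`.
[cite: Balaban1985BackgroundPropagators, (3.77) p.406 + (3.49) p.399 + (3.25) p.394 + Thm 3.1/3.2 pp.397–398; Balaban1984PropagatorsII, Lemma 2.1 p.234] -/
theorem ineq377_op_of_349 (blk : W → g.Site) (d : ℕ) (δ₀ δ α β ρ₁ ρ Λ κQ B₀ B₁ cE κP' α₁ : ℝ)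
    (hκQ : 0 ≤ κQ) (hB₀ : 0 ≤ B₀) (hB₁ : 0 ≤ B₁) (hcE : 0 ≤ cE) (hκP' : 0 ≤ κP') (hα₁ : 0 ≤ α₁) (hΛ : 1 ≤ Λ)
    (hρ₁ : 0 ≤ ρ₁) (hρ : 0 ≤ ρ) (hα : 0 ≤ α) (hβ : 0 ≤ β) (hδ₀ : 0 ≤ δ₀)
    (hr₁ : ρ₁ + (2 * α + β) * δ₀ ≤ δ) (hr : ρ + 2 * ((α + β) * δ₀) ≤ ρ₁)
    (hdnn : ∀ a b : g.Site, 0 ≤ g.dist a b) (htri : Triangle254 (toB6 g R H)) (hlen : ∀ y : g.Site, 0 < g.len y)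
    (h261 : Ineq261 d (toB6 g R H) δ₀ β)
    (hT1 : ScaleTransfer g δ₀ α Λ (fun a => g.len a)) (hT2 : ScaleTransfer g δ₀ α Λ (fun a => g.len a ^ 2))
    (hT4 : ScaleTransfer g δ₀ α Λ (fun a => (g.len a ^ 4)⁻¹)) (hT1i : ScaleTransfer g δ₀ α Λ (fun a => (g.len a)⁻¹))
    {G D Ds Qs Q Cinv D' Ds' E Es Pp : Module.End ℝ (W → ℝ)} (hD' : D' = D + E) (hDs' : Ds' = Ds + Es)
    (hQ : HasMajorant (g := toB6 g R H) blk Q (fun a b : g.Site => if a = b then κQ else 0))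
    (hQs : HasMajorant (g := toB6 g R H) blk Qs (fun a b : g.Site => if a = b then κQ else 0))
    (hG : HasMajorant (g := toB6 g R H) blk G (fun a b => B₀ * g.len a ^ 2 * Real.exp (-(δ * g.dist a b))))
    (hDG : HasMajorant (g := toB6 g R H) blk (D * G) (fun a b => B₀ * g.len a * Real.exp (-(δ * g.dist a b))))
    (hGDs : HasMajorant (g := toB6 g R H) blk (G * Ds) (fun a b => B₀ * g.len a * Real.exp (-(δ * g.dist a b))))
    (hCinv : HasMajorant (g := toB6 g R H) blk Cinv
      (fun a b => B₁ * (g.len a ^ 4)⁻¹ * Real.exp (-(δ * g.dist a b))))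
    (hPp : HasMajorant (g := toB6 g R H) blk Pp (fun a b => κP' * α₁ * Real.exp (-(ρ₁ * g.dist a b))))
    (hDPp : HasMajorant (g := toB6 g R H) blk (D * Pp)
      (fun a b => κP' * α₁ * (g.len a)⁻¹ * Real.exp (-(ρ₁ * g.dist a b))))
    (hPpDs : HasMajorant (g := toB6 g R H) blk (Pp * Ds)
      (fun a b => κP' * α₁ * (g.len a)⁻¹ * Real.exp (-(ρ₁ * g.dist a b))))
    (hDPpDs : HasMajorant (g := toB6 g R H) blk (D * Pp * Ds)
      (fun a b => κP' * α₁ * (g.len a ^ 2)⁻¹ * Real.exp (-(ρ₁ * g.dist a b))))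
    (hE : HasMajorant (g := toB6 g R H) blk E (fun a b => cE * α₁ * (g.len a)⁻¹ * Real.exp (-(ρ₁ * g.dist a b))))
    (hEs : HasMajorant (g := toB6 g R H) blk Es
      (fun a b => cE * α₁ * (g.len a)⁻¹ * Real.exp (-(ρ₁ * g.dist a b)))) :
    HasMajorant (g := toB6 g R H) blk (pOne D D' Ds Ds' (B9Eq360Vprime.pOp G Qs Cinv Q) Pp)
      (fun a b => kappa377 cE (B9Ineq368PPrime.kappa349 κQ B₀ B₁ Λ (B6.c1 d δ₀ β)) κP' Λ (B6.c1 d δ₀ β) α₁ * α₁ *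
        (g.len a ^ 2)⁻¹ * Real.exp (-(ρ * g.dist a b))) := by
  obtain ⟨hP, hDP, hPDs, -⟩ := B9Ineq368PPrime.ineq349_op (R := R) (H := H) blk d δ₀ δ α β ρ₁ Λ κQ B₀ B₁ hκQ hB₀
    hB₁ hΛ hρ₁ hα hβ hδ₀ hr₁ hdnn htri hlen h261 hT1 hT2 hT4 hQ hQs hG hDG hGDs hCinv
  have hκ : 0 ≤ B9Ineq368PPrime.kappa349 κQ B₀ B₁ Λ (B6.c1 d δ₀ β) := by
    unfold B9Ineq368PPrime.kappa349
    have := B6RandomWalk.c1_nonneg d δ₀ β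
    have hΛ0 : 0 ≤ Λ := zero_le_one.trans hΛ
    positivity
  exact ineq377_op (R := R) (H := H) blk d δ₀ ρ₁ α β ρ Λ cE _ κP' α₁ hcE hκ hκP' hα₁ hΛ hρ hα hβ hδ₀ hr hdnn htri
    hlen h261 hT1i hD' hDs' hP hDP hPDs hPp hDPp hPpDs hDPpDs hE hEs

end Assembly

end Literature.MathematicalPhysics.QuantumFieldTheory.Balaban1983to89.B9Ineq377POne

end
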